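import Summits.Ventures.CertifiedArithmetic.LowPrec.DoubleRoundingDivisionUnderflow

/-!
# Double rounding of quotients: the decision on records `(P, L, M)` (THEOREM D-div decided)

HONEST FRAMING (venture CertifiedArithmetic / cell `pub-lowprec`): certified error envelopes and
provably optimal rounding/accumulation schemes for low-precision formats under stated cost models;
every table by two implementations; no hardware or vendor claims.

With clause (Q) (`drDiv_of_clause`), THEOREM N-div-S (`not_drDiv_of_strip`), THEOREM N-div-E
(`not_drDiv_of_equal_precision`), THEOREM N-div-U (`not_drDiv_of_underflow`,
`not_drDiv_of_underflow_low`) and a same-grid lemma, the double-rounding predicate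
`DRDiv φ ψ` (`fl_φ (fl_ψ (a / b)) = fl_φ (a / b)` for all data of `φ`) is DECIDED on the parameters
`(P, L, M)` for every embedded pair whose narrow format has the (mild, named-format) ranges of
`divRoomy`:  `DRDiv φ ψ ↔ (P_ψ = P_φ ∧ L_ψ = L_φ) ∨ (P_ψ ≥ 2 P_φ ∧ L_ψ + P_φ ≤ L_φ)`
(`drDiv_iff_of_embeds`) — the ÷ analogue of the one-test decision `drAdd_iff_test` for sums.

* §1 THE DECISION FOR A WIDER SIGNIFICAND (`drDiv_iff_clause_of_wider`): `embedsTest φ ψ`,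
  `m + 1 ≤ m_ψ`, `divRoomy φ` `⟹ (DRDiv φ ψ ↔ 2m + 1 ≤ m_ψ ∧ L_ψ + m + 1 ≤ L_φ)`: (⇐) is (Q);
  (⇒) `d ≤ m - 1` by (U0), `d = m` by (U1), `d ≥ m + 1 ∧ m_ψ ≤ 2m` by N-div-S at `k = 0`.  So BOTH
  conditions of (Q) are necessary and (Q) is the exact law for wider intermediates
  (`underflow_clause_of_drDiv`).
* §2 EQUAL PRECISION AND THE FULL DECISION: `toRat_roundNE_roundNE_of_qexp_eq` (same `m ≥ 1`, same
  quantum, `maxRat φ ≤ maxRat ψ`, `2^m ≤ M_φ` `⟹ fl_φ ∘ fl_ψ = fl_φ` at every rational — the grids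
  agree below `maxRat φ`; generalises `toRat_roundNE_roundNE_of_sameGrid`, which wanted equal
  `emaxCode` and `bias`), hence `drDiv_of_qexp_eq`; with N-div-E, `drDiv_iff_of_embeds`:
  `embedsTest φ ψ`, `divRoomy φ` `⟹
  (DRDiv φ ψ ↔ (m_ψ = m ∧ L_ψ = L_φ) ∨ (2m + 1 ≤ m_ψ ∧ L_ψ + m + 1 ≤ L_φ))`.  `divRoomy` holds on
  all `13` named records (`divRoomy_of_mem_namedFormats`), so the named ÷ matrix is this law
  (`drDiv_named_iff_law`; `drDivPairs_eq_law` re-reads the certified table `drDivPairs`).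

Two implementations: A = `code/enum/div_underflow_law.py`, Part 3 (exact rationals, THE DECISION
by brute force over all operand pairs of `61` pseudo-records `X` against `P_X ≤ P_Y ≤ 2 P_X + 2`,
`0 ≤ d ≤ P_X + 1`, tight and roomy tops — `2192` in-scope rows, law = brute force on every one,
and `508` of `2080` out-of-scope rows (degenerate ranges) where `DRDiv` holds although the law
says no, so range hypotheses are needed — `DRDiv` is not even invariant under a common rescaling
of `X` and `Y`: the quotient set is scale-free, the grids are not) and Part 4 (the law re-derived
on the `67` embedded named cells) → `certs/enum/DOUBLE-ROUNDING-DIV-UNDERFLOW.json`; B = the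
kernel (this file).  PLACEMENT — KNOWN: sufficiency [Figueroa1995, §3; Roux2014, §5.1 Thm. 29,
Table II]; the necessity halves are this packet's THEOREMS N-div-S / N-div-E / N-div-U (placement
in their files).  NEW here: the record-level decision of `DRDiv` on `(P, L, M)` and its agreement
with the certified `13 × 13` table.  No hardware or vendor claims.
-/

namespace Summit.Ventures.CertifiedArithmetic

open Literature.ComputerArithmetic.FloatingPoint
open Literature.ComputerArithmetic.FloatingPoint.Format
open Literature.ComputerArithmetic.FloatingPoint.MiniFloat

/-! ## §1 The decision for a wider significand -/

/-- THE RANGES the decision asks of the narrow record `X` (`m = m_X`, `L = L_X`, `M = M_X`):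
`m ≥ 1`; the window `2^(m+1) + 2 ≤ M` of (U0) / N-div-S at `k = 0`; their data `2^n₁`,
`(2^(m+1) - 1)·2^c₁` (`c₁ = max (0, -(2m + 2 + L))`, `n₁ = 2m + 2 + c₁ + L`); the data `2^i₂`,
`(2^(m+1) - 1)·2^c₂` of (U1) (`c₂ = max (0, -(m + L))`, `i₂ = m + c₂ + L`); and the data `2^i₃`,
`3·2^t₃` of N-div-E (`t₃ = max (0, -(L + m + 1))`, `i₃ = m + 1 + t₃ + L`).  For instance every
record with `m ≥ 1`, `bias ≥ m + 3` and `maxRat ≥ 2` has them; all `13` named records do.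
[this packet] -/
def divRoomy (X : Format) : Bool :=
  let c₁ := (-(2 * (X.manBits : ℤ) + 2 + X.qexp)).toNat
  let n₁ := (2 * (X.manBits : ℤ) + 2 + c₁ + X.qexp).toNat
  let c₂ := (-((X.manBits : ℤ) + X.qexp)).toNat
  let i₂ := ((X.manBits : ℤ) + c₂ + X.qexp).toNat
  let t₃ := (-(X.qexp + X.manBits + 1)).toNat
  let i₃ := ((X.manBits : ℤ) + 1 + t₃ + X.qexp).toNat
  decide (1 ≤ X.manBits) && decide (2 ^ (X.manBits + 1) + 2 ≤ X.maxScaled) &&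
  decide (2 ^ n₁ ≤ X.maxScaled) && decide ((2 ^ (X.manBits + 1) - 1) * 2 ^ c₁ ≤ X.maxScaled) &&
  decide (2 ^ i₂ ≤ X.maxScaled) && decide ((2 ^ (X.manBits + 1) - 1) * 2 ^ c₂ ≤ X.maxScaled) &&
  decide (2 ^ i₃ ≤ X.maxScaled) && decide (3 * 2 ^ t₃ ≤ X.maxScaled)

/-- ALL `13` NAMED RECORDS have the ranges of `divRoomy`. [this packet] -/
theorem divRoomy_of_mem_namedFormats : ∀ X ∈ namedFormats, divRoomy X = true := by
  decide +kernel

/-- THE DECISION FOR A WIDER SIGNIFICAND: for `F_φ ⊆ F_ψ` (`embedsTest`), `m_φ + 1 ≤ m_ψ` and a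
roomy `φ`, `DRDiv φ ψ ↔ 2 m_φ + 1 ≤ m_ψ ∧ L_ψ + m_φ + 1 ≤ L_φ` — clause (Q) is the exact law:
(⇐) `drDiv_of_clause`; (⇒) `d ≤ m - 1` by (U0) at `k = 0`, `d = m` by (U1), `d ≥ m + 1` with
`m_ψ ≤ 2m` by THEOREM N-div-S at `k = 0`. [this packet] -/
theorem drDiv_iff_clause_of_wider {φ ψ : Format} (hE : embedsTest φ ψ = true)
    (hw : φ.manBits + 1 ≤ ψ.manBits) (hR : divRoomy φ = true) :
    DRDiv φ ψ ↔ 2 * φ.manBits + 1 ≤ ψ.manBits ∧ ψ.qexp + φ.manBits + 1 ≤ φ.qexp := by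
  have hE' := hE
  simp only [embedsTest, Bool.and_eq_true, decide_eq_true_eq] at hE'
  obtain ⟨⟨-, hq⟩, hM⟩ := hE'
  have hR' := hR
  simp only [divRoomy, Bool.and_eq_true, decide_eq_true_eq] at hR'
  obtain ⟨⟨⟨⟨⟨⟨⟨h1, hu⟩, hn1⟩, hc1⟩, hi2⟩, hc2⟩, -⟩, -⟩ := hR'
  have hm2 : 2 ≤ 2 ^ φ.manBits := le_trans (by norm_num) (Nat.pow_le_pow_right (by norm_num) h1)
  have hpow : 2 ^ (φ.manBits + 1) = 2 * 2 ^ φ.manBits := pow_succ' 2 _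
  have hMu : 1 ≤ φ.maxScaled := le_trans (by norm_num) (le_trans (Nat.le_add_left 2 _) hu)
  constructor
  · intro hD
    by_contra hne
    by_cases hdm : (φ.qexp - ψ.qexp).toNat + 1 ≤ φ.manBits
    · -- `d ≤ m - 1`: (U0) at `k = 0`
      refine not_drDiv_of_underflow_low (k := 0) hq hw (by omega) (by omega) hn1 hc1
        (by simpa using hu) ?_ hD
      rw [zero_add]
      exact le_trans (Nat.mul_le_mul_right _ (by omega)) hM
    · by_cases hdm' : (φ.qexp - ψ.qexp).toNat ≤ φ.manBits
      · -- `d = m`: (U1)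
        refine not_drDiv_of_underflow (by omega) (by omega) h1 (by omega) hi2 hc2 ?_ hD
        exact le_trans (le_trans (Nat.pow_le_pow_right (by norm_num) (Nat.sub_le _ _))
          (Nat.le_mul_of_pos_left _ (by omega))) hM
      · -- `d ≥ m + 1`: the underflow clause holds, so `m_ψ ≤ 2m` and N-div-S applies at `k = 0`
        have hhi : ψ.manBits ≤ 2 * φ.manBits := by omega
        refine not_drDiv_of_strip (k := 0) hq hw hhi (by omega) hn1 hc1 (by simpa using hu) ?_
          (by omega) hD
        rw [zero_add]
        exact le_trans (Nat.mul_le_mul_right _ (by omega)) hM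
  · rintro ⟨hm, hD⟩
    exact drDiv_of_clause hE hm hD h1

/-- COROLLARY (NECESSITY OF THE UNDERFLOW CLAUSE): a wider embedded intermediate that
double-rounds the quotients of a roomy `φ` correctly has a quantum at least `P_φ = m_φ + 1`
binades finer. [this packet] -/
theorem underflow_clause_of_drDiv {φ ψ : Format} (hE : embedsTest φ ψ = true)
    (hw : φ.manBits + 1 ≤ ψ.manBits) (hR : divRoomy φ = true) (h : DRDiv φ ψ) :
    ψ.qexp + φ.manBits + 1 ≤ φ.qexp :=
  ((drDiv_iff_clause_of_wider hE hw hR).mp h).2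

/-! ## §2 Equal precision, and the decision on `(P, L, M)` -/

/-- SAME PRECISION AND QUANTUM: BELOW `2^m` QUANTA THE TWO ROUNDINGS AGREE (both formats carry the
whole grid `k·q`, `k ≤ 2^m`, when `2^m ≤ M`). [folklore] -/
theorem toRat_roundNE_eq_of_qexp_eq_of_abs_lt {φ ψ : Format} (hm : φ.manBits = ψ.manBits)
    (hqe : φ.qexp = ψ.qexp) (hN : 2 ^ φ.manBits ≤ φ.maxScaled)
    (hNψ : 2 ^ ψ.manBits ≤ ψ.maxScaled) {x : ℚ} (hx : |x| < 2 ^ φ.manBits * φ.quantum) :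
    (roundNE ψ x).toRat = (roundNE φ x).toRat := by
  have hq0 := φ.quantum_pos
  have hq : ψ.quantum = φ.quantum := by unfold Format.quantum; rw [hqe]
  rw [toRat_roundNE (φ := ψ) x, toRat_roundNE (φ := φ) x, hq]
  set r := |x| / φ.quantum with hr_def
  have hr0 : 0 ≤ r := div_nonneg (abs_nonneg x) hq0.le
  have hrlt : r < 2 ^ φ.manBits := by rw [hr_def, div_lt_iff₀ hq0]; exact hx
  have hfl : ⌊r⌋.toNat < 2 ^ (φ.manBits + 1) := by
    have h1 : ((⌊r⌋.toNat : ℕ) : ℚ) ≤ r := Format.floor_toNat_le hr0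
    have h3 : (2 : ℚ) ^ φ.manBits ≤ 2 ^ (φ.manBits + 1) :=
      pow_le_pow_right₀ (by norm_num) (by omega)
    have h2 : ((⌊r⌋.toNat : ℕ) : ℚ) < ((2 ^ (φ.manBits + 1) : ℕ) : ℚ) := by
      push_cast; linarith
    exact_mod_cast h2
  have hRle : (rneInt r).toNat ≤ 2 ^ φ.manBits := by
    have h := rneInt_le_of_le (k := ((2 ^ φ.manBits : ℕ) : ℤ)) (by push_cast; exact hrlt.le)
    exact Int.toNat_le.mpr h
  have key : ∀ χ : Format, χ.manBits = φ.manBits → 2 ^ χ.manBits ≤ χ.maxScaled →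
      χ.rneGrid r = (rneInt r).toNat := by
    intro χ hχ hχN
    rw [Format.rneGrid_eq_min]
    unfold Format.rneMult
    rw [shift_eq_zero_of_lt (by rw [hχ]; exact hfl)]
    simp only [pow_zero, div_one, mul_one]
    exact min_eq_left (le_trans hRle (by rw [← hχ]; exact hχN))
  rw [key ψ hm.symm hNψ, key φ rfl hN]

/-- SAME PRECISION `m ≥ 1`, SAME QUANTUM, AT LEAST THE RANGE (`maxRat φ ≤ maxRat ψ`, `2^m ≤ M_φ`):
`fl_φ ∘ fl_ψ = fl_φ` at EVERY rational — double rounding through `ψ` is innocuous for every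
operation (below `maxRat φ` the two value grids agree, above it both sides saturate).  Generalises
`toRat_roundNE_roundNE_of_sameGrid` (which asked equal `emaxCode` and `bias`). [folklore] -/
theorem toRat_roundNE_roundNE_of_qexp_eq {φ ψ : Format} (hm : φ.manBits = ψ.manBits)
    (h1 : 1 ≤ φ.manBits) (hqe : φ.qexp = ψ.qexp) (hN : 2 ^ φ.manBits ≤ φ.maxScaled)
    (hM : φ.maxRat ≤ ψ.maxRat) (x : ℚ) :
    (roundNE φ (roundNE ψ x).toRat).toRat = (roundNE φ x).toRat := by
  rcases le_or_gt (2 ^ φ.manBits * φ.quantum) |x| with hhi | hlo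
  · exact toRat_roundNE_roundNE_of_manBits_eq_of_le hm h1 (le_of_eq hqe.symm) hM hhi
  · have hq : ψ.quantum = φ.quantum := by unfold Format.quantum; rw [hqe]
    have hMM : φ.maxScaled ≤ ψ.maxScaled := by
      have h := hM
      unfold Format.maxRat at h
      rw [hq] at h
      exact_mod_cast le_of_mul_le_mul_right h φ.quantum_pos
    have hNψ : 2 ^ ψ.manBits ≤ ψ.maxScaled := by rw [← hm]; exact hN.trans hMM
    rw [toRat_roundNE_eq_of_qexp_eq_of_abs_lt hm hqe hN hNψ hlo, toRat_roundNE_toRat]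

/-- EQUAL PRECISION, EQUAL QUANTUM, NESTED RANGES `⟹ DRDiv`. [this packet] -/
theorem drDiv_of_qexp_eq {φ ψ : Format} (hm : φ.manBits = ψ.manBits) (h1 : 1 ≤ φ.manBits)
    (hqe : φ.qexp = ψ.qexp) (hN : 2 ^ φ.manBits ≤ φ.maxScaled) (hM : φ.maxRat ≤ ψ.maxRat) :
    DRDiv φ ψ :=
  fun _ _ => toRat_roundNE_roundNE_of_qexp_eq hm h1 hqe hN hM _

/-- THE DECISION ON `(P, L, M)`: for `F_φ ⊆ F_ψ` (`embedsTest`) and a roomy `φ`,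
`DRDiv φ ψ ↔ (m_ψ = m_φ ∧ L_ψ = L_φ) ∨ (2 m_φ + 1 ≤ m_ψ ∧ L_ψ + m_φ + 1 ≤ L_φ)`: an embedded
intermediate double-rounds quotients correctly iff it has the same precision and quantum (same
grid) or satisfies clause (Q).  (⇒) equal precision with a finer quantum by THEOREM N-div-E, wider
by `drDiv_iff_clause_of_wider`; (⇐) `drDiv_of_qexp_eq` / `drDiv_of_clause`. [this packet] -/
theorem drDiv_iff_of_embeds {φ ψ : Format} (hE : embedsTest φ ψ = true) (hR : divRoomy φ = true) :
    DRDiv φ ψ ↔ (ψ.manBits = φ.manBits ∧ ψ.qexp = φ.qexp) ∨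
      (2 * φ.manBits + 1 ≤ ψ.manBits ∧ ψ.qexp + φ.manBits + 1 ≤ φ.qexp) := by
  have hE' := hE
  simp only [embedsTest, Bool.and_eq_true, decide_eq_true_eq] at hE'
  obtain ⟨⟨hmle, hq⟩, hM⟩ := hE'
  have hR' := hR
  simp only [divRoomy, Bool.and_eq_true, decide_eq_true_eq] at hR'
  obtain ⟨⟨⟨⟨⟨⟨⟨h1, hu⟩, -⟩, -⟩, -⟩, -⟩, hi3⟩, hb3⟩ := hR'
  have hm2 : 2 ≤ 2 ^ φ.manBits := le_trans (by norm_num) (Nat.pow_le_pow_right (by norm_num) h1)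
  have hpow : 2 ^ (φ.manBits + 1) = 2 * 2 ^ φ.manBits := pow_succ' 2 _
  have hN : 2 ^ φ.manBits ≤ φ.maxScaled := by omega
  constructor
  · intro hD
    by_contra hne
    rcases Nat.eq_or_lt_of_le hmle with heq | hlt
    · -- equal precision with a finer quantum: THEOREM N-div-E
      have hq1 : ψ.qexp + 1 ≤ φ.qexp := by omega
      exact not_drDiv_of_equal_precision hq1 heq.symm h1 (by omega) hi3 hb3 hN
        (le_trans (Nat.mul_le_mul_right _ hN) hM) hD
    · exact hne (Or.inr ((drDiv_iff_clause_of_wider hE hlt hR).mp hD))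
  · rintro (⟨hm, hqe⟩ | ⟨hm, hqD⟩)
    · have hd0 : (φ.qexp - ψ.qexp).toNat = 0 := by omega
      rw [hd0, pow_zero, mul_one] at hM
      refine drDiv_of_qexp_eq hm.symm h1 hqe.symm hN ?_
      have hqq : ψ.quantum = φ.quantum := by unfold Format.quantum; rw [hqe]
      unfold Format.maxRat
      rw [hqq]
      exact mul_le_mul_of_nonneg_right (by exact_mod_cast hM) φ.quantum_pos.le
    · exact drDiv_of_clause hE hm hqD h1

/-- THE NAMED ÷ MATRIX IS THE LAW: for named `X`, `Y`, `DRDiv X Y` iff `X ⊆ Y` and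
(`P_Y = P_X ∧ L_Y = L_X`, or `P_Y ≥ 2 P_X ∧ L_Y + P_X ≤ L_X`) — by `embeds_of_drDiv_named`,
`divRoomy_of_mem_namedFormats` and `drDiv_iff_of_embeds`; no witness table and no exhaustion.
[this packet] -/
theorem drDiv_named_iff_law {X Y : Format} (hX : X ∈ namedFormats) (hY : Y ∈ namedFormats) :
    DRDiv X Y ↔ embedsTest X Y = true ∧ ((Y.manBits = X.manBits ∧ Y.qexp = X.qexp) ∨
      (2 * X.manBits + 1 ≤ Y.manBits ∧ Y.qexp + X.manBits + 1 ≤ X.qexp)) := by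
  constructor
  · intro h
    have he := (embeds_iff_test (stdOperand_of_mem_namedFormats X hX)).mp
      (embeds_of_drDiv_named hX hY h)
    exact ⟨he, (drDiv_iff_of_embeds he (divRoomy_of_mem_namedFormats X hX)).mp h⟩
  · rintro ⟨he, h⟩
    exact (drDiv_iff_of_embeds he (divRoomy_of_mem_namedFormats X hX)).mpr h

/-- CROSS-CHECK AGAINST THE CERTIFIED TABLE: the `51` cells of `drDivPairs`
(`DoubleRoundingDivisionMatrix.lean`) are exactly the named pairs selected by the law.
[this packet] -/
theorem drDivPairs_eq_law : drDivPairs = namedPairs.filter (fun p : Format × Format =>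
    embedsTest p.1 p.2 &&
    ((decide (p.2.manBits = p.1.manBits) && decide (p.2.qexp = p.1.qexp)) ||
     (decide (2 * p.1.manBits + 1 ≤ p.2.manBits) &&
      decide (p.2.qexp + (p.1.manBits : ℤ) + 1 ≤ p.1.qexp)))) := by
  decide +kernel

end Summit.Ventures.CertifiedArithmetic
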